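import Literature.Analysis.FluidPDE.NSWeakStrongUniquenessProofs
import Literature.Analysis.FluidPDE.LerayHopfTimeSlice
import Literature.Analysis.FluidPDE.LerayHopfSpatialGradient
import Literature.Analysis.FluidPDE.SolenoidalTruncation
import Literature.Analysis.FunctionSpaces.TimeMollification
import HarnessLib

/-!
# Leray–Hopf solutions tested with `H¹_σ` fields (time-sliced form)

Analysis/FluidPDE support file (serves the discharge of the Serrin–Prodi weak–strong uniqueness
theorem `Literature.Analysis.FluidPDE.weak_strong_uniqueness`, sub-fact `Literature.Analysis.FluidPDE.serrin_difference_energy_ineq`: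
Serrin's argument tests the weak formulation of one Leray–Hopf solution with the other, i.e. with
a field that is only in `H¹_σ = {Ψ ∈ L², div Ψ = 0 weakly, ∇Ψ ∈ L²}`; Serrin 1963, §4; Galdi 2000,
Lemma 2.1 / (4.3); Robinson–Rodrigo–Sadowski 2016, (8.12)).

**Main result** (`Fluid.IsLerayHopfOn.inner_weakGrad_test_eq`, the `H¹_σ` time-slice identity).
Let `dim E = 3`, `u` a Leray–Hopf weak solution of the unforced Navier–Stokes system on
`E × [0,T)` with datum `u₀`, `Gu` a jointly measurable weak-gradient witness of `u` (a.e. in time)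
with `∫₀ᵀ∫ |Gu|² < ∞`, and `Ψ ∈ L²(E;E)` weakly divergence free with weak gradient `GΨ`,
`∫ |GΨ|² < ∞`. Then for **every** `t ∈ (0, T]`
`⟨u(t), Ψ⟩ = ⟨u₀, Ψ⟩ + ∫_{(0,t]} ( ∫ ⟪GΨ·u, u⟫ - ν Σᵢ ∫ ⟪Gu eᵢ, GΨ eᵢ⟫ ) ds`
(Galdi 2000, Lemma 2.1 with (2.8); Serrin 1963, (6)): the accepted smooth-test version
`IsLerayHopfOn.inner_test_eq` extended by the density of `C_{c,σ}^∞` in `H¹_σ`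
(`Fluid.exists_isDivFree_test_approx`), using `⟨u, ΔΦ⟩ = -⟨∇u, ∇Φ⟩`
(`HasWeakGradient.integral_inner_laplacian_test`) and the bound
`|∫ ⟪(DΦₙ - GΨ) u, u⟫| ≤ ‖DΦₙ - GΨ‖₂ ‖u‖₄²` with `∫₀ᵀ ‖u‖₄² < ∞` (Sobolev `H¹ ⊂ L⁶` in
dimension `3`, `Fluid.eLpNorm_six_le_frobenius_of_hasWeakGradient`, and Lebesgue interpolation).

Also proved here, as needed by the cross-identity file:
* `Fluid.exists_stronglyMeasurable_weakGradient`: an a.e.-in-time weak gradient of an a.e.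
  jointly measurable field admits a **jointly measurable** version (a thin wrapper of the
  accepted `Fluid.exists_stronglyMeasurable_of_sliced_weakGradient`);
* `Fluid.lintegral_rpow_enorm_interpolate` / `Fluid.eLpNorm_le_eLpNorm_two_rpow_mul_eLpNorm_six_rpow`:
  Lebesgue interpolation (Robinson–Rodrigo–Sadowski 2016, Thm. 1.5);
* `Fluid.IsLerayHopfOn.lintegral_eLpNorm_four_sq_lt_top`: `∫₀ᵀ ‖u(s)‖₄² ds < ∞` for a
  Leray–Hopf solution in dimension `3` (RRS 2016, Lemma 3.5-type bound `u ∈ L^{8/3}(0,T;L⁴)`).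

## Mathlib search

Mathlib (this pin) has Hölder's inequality in the two-exponent form
`ENNReal.lintegral_mul_norm_pow_le`, but no Leray–Hopf theory and no Lebesgue-interpolation
statement for `eLpNorm` (searched `interpol`, `eLpNorm_le_eLpNorm_mul` in
`MeasureTheory/Function/LpSeminorm`, `MeasureTheory/Integral`). The tree supplies everything
fluid-specific (see imports; `HasWeakGradient.congr_ae`/`congr_grad_ae` and the measurable
gradient selection are the accepted `LerayHopfSpatialGradient`).

## References

* G. P. Galdi, *An introduction to the Navier–Stokes initial–boundary value problem*, in:
  Fundamental Directions in Mathematical Fluid Mechanics, Birkhäuser 2000, Lemma 2.1, Def. 2.1,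
  Thm. 4.2 (`Galdi2000`).
* J. Serrin, *The initial value problem for the Navier–Stokes equations*, in: Nonlinear Problems
  (Madison 1962), Univ. Wisconsin Press 1963, §§3–4 (`Serrin1963`).
* J. C. Robinson, J. L. Rodrigo, W. Sadowski, *The Three-Dimensional Navier–Stokes Equations*,
  CUP 2016, Thm. 1.5, Lemma 3.5, Lemma 8.18, (8.12) (`RobinsonRodrigoSadowski2016`).
-/

noncomputable section

open MeasureTheory TopologicalSpace Set Function Filter Topology ContinuousLinearMap Module
open scoped ENNReal NNReal Convolution InnerProductSpace RealInnerProductSpace Laplacian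

namespace Literature.Analysis.FluidPDE

variable {E : Type*} [NormedAddCommGroup E] [InnerProductSpace ℝ E] [FiniteDimensional ℝ E]
  [MeasurableSpace E] [BorelSpace E]

/-! ### A jointly measurable weak-gradient witness -/

section Witness

/-- **Jointly measurable weak-gradient witnesses.** Let `u : ℝ × E → E` be a.e. jointly measurable
on `(0,T) × E` and let `G t` be a weak gradient of `u t` for a.e. `t ∈ (0,T)`. Then there is a
jointly (strongly) measurable `G' : ℝ × E → (E →L[ℝ] E)` with `G' t = G t` a.e. in space for a.e.
`t ∈ (0,T)` (so `G' t` is again a weak gradient of `u t` for a.e. `t`, with the same slice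
integrals). This is the accepted `Fluid.exists_stronglyMeasurable_of_sliced_weakGradient`
(`LerayHopfSpatialGradient`) applied to a strongly measurable version of `u`, whose slices agree
with `u t` a.e. for a.e. `t`. [folklore] -/
theorem exists_stronglyMeasurable_weakGradient {T : ℝ} {u : ℝ → E → E}
    {G : ℝ → E → E →L[ℝ] E}
    (hu : AEStronglyMeasurable (uncurry u) (volume.restrict (Ioo 0 T ×ˢ univ)))
    (hG : ∀ᵐ t ∂(volume.restrict (Ioo 0 T)), HasWeakGradient (u t) (G t)) :
    ∃ G' : ℝ → E → E →L[ℝ] E, StronglyMeasurable (uncurry G') ∧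
      ∀ᵐ t ∂(volume.restrict (Ioo 0 T)), G' t =ᵐ[volume] G t := by
  set U : ℝ × E → E := hu.mk (uncurry u) with hUdef
  have hU : StronglyMeasurable U := hu.stronglyMeasurable_mk
  have hae : uncurry u =ᵐ[volume.restrict (Ioo 0 T ×ˢ (univ : Set E))] U := hu.ae_eq_mk
  rw [← restrict_prod_volume_eq T] at hae
  have hslice : ∀ᵐ t ∂(volume.restrict (Ioo 0 T)), (fun y => U (t, y)) =ᵐ[volume] u t := by
    filter_upwards [Measure.ae_ae_of_ae_prod hae] with t ht
    filter_upwards [ht] with x hx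
    exact hx.symm
  have hGU : ∀ᵐ t ∂(volume.restrict (Ioo 0 T)), HasWeakGradient (fun y => U (t, y)) (G t) := by
    filter_upwards [hG, hslice] with t ht hs
    exact ht.congr_ae hs
  obtain ⟨G'', hG''m, hG''ae⟩ := exists_stronglyMeasurable_of_sliced_weakGradient hU hGU
  exact ⟨fun t x => G'' (t, x), hG''m, hG''ae⟩

end Witness

/-! ### Lebesgue interpolation -/

section Interpolation

/-- `x^t ≤ 1 + x` in `ℝ≥0∞` for `0 ≤ t ≤ 1`. [folklore] -/
theorem _root_.ENNReal.rpow_le_one_add_self (x : ℝ≥0∞) {t : ℝ} (ht0 : 0 ≤ t) (ht1 : t ≤ 1) :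
    x ^ t ≤ 1 + x := by
  rcases le_total x 1 with hx | hx
  · exact (ENNReal.rpow_le_one hx ht0).trans le_self_add
  · calc x ^ t ≤ x ^ (1 : ℝ) := ENNReal.rpow_le_rpow_of_exponent_le hx ht1
      _ = x := ENNReal.rpow_one x
      _ ≤ 1 + x := le_add_self

/-- **Lebesgue interpolation** (lower-integral form): for `0 < a < b`, `a ≤ r ≤ b`,
`∫ f^r ≤ (∫ f^a)^{(b-r)/(b-a)} (∫ f^b)^{(r-a)/(b-a)}` (Robinson–Rodrigo–Sadowski 2016, Thm. 1.5;
Hölder with the two exponents summing to `1`). [cite: RobinsonRodrigoSadowski2016, Thm. 1.5] -/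
theorem lintegral_rpow_interpolate {α : Type*} [MeasurableSpace α] {μ : Measure α}
    {f : α → ℝ≥0∞} (hf : AEMeasurable f μ) {a b r : ℝ} (ha : 0 < a) (hab : a < b)
    (har : a ≤ r) (hrb : r ≤ b) :
    ∫⁻ x, f x ^ r ∂μ ≤
      (∫⁻ x, f x ^ a ∂μ) ^ ((b - r) / (b - a)) * (∫⁻ x, f x ^ b ∂μ) ^ ((r - a) / (b - a)) := by
  have hba : 0 < b - a := sub_pos.2 hab
  set α' : ℝ := (b - r) / (b - a) with hα'
  set β' : ℝ := (r - a) / (b - a) with hβ'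
  have hα'0 : 0 ≤ α' := div_nonneg (sub_nonneg.2 hrb) hba.le
  have hβ'0 : 0 ≤ β' := div_nonneg (sub_nonneg.2 har) hba.le
  have hsum : α' + β' = 1 := by
    rw [hα', hβ', ← add_div, div_eq_one_iff_eq hba.ne']; ring
  have hexp : a * α' + b * β' = r := by
    rw [hα', hβ']; field_simp; ring
  have hpt : ∀ x, f x ^ r = (f x ^ a) ^ α' * (f x ^ b) ^ β' := by
    intro x
    rw [← ENNReal.rpow_mul, ← ENNReal.rpow_mul, ← ENNReal.rpow_add_of_nonneg _ _
      (mul_nonneg ha.le hα'0) (mul_nonneg (ha.le.trans hab.le) hβ'0), hexp]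
  simp_rw [hpt]
  exact ENNReal.lintegral_mul_norm_pow_le (hf.pow_const a) (hf.pow_const b) hα'0 hβ'0 hsum

/-- **Lebesgue interpolation between `L²` and `L⁶`**: for `2 ≤ p ≤ 6`,
`‖f‖_p ≤ ‖f‖₂^{3/p - 1/2} ‖f‖₆^{3/2 - 3/p}` (Robinson–Rodrigo–Sadowski 2016, Thm. 1.5, the case
used in the proof of Lemma 8.18 / Thm. 8.19 with `p = 2s/(s-2)`). [cite: RobinsonRodrigoSadowski2016, Thm. 1.5] -/
theorem eLpNorm_le_eLpNorm_two_rpow_mul_eLpNorm_six_rpow {α : Type*} [MeasurableSpace α]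
    {μ : Measure α} {F : Type*} [NormedAddCommGroup F] {f : α → F}
    (hf : AEStronglyMeasurable f μ) {p : ℝ≥0∞} (h2p : 2 ≤ p) (hp6 : p ≤ 6) :
    eLpNorm f p μ ≤ eLpNorm f 2 μ ^ (3 / p.toReal - 1 / 2) *
      eLpNorm f 6 μ ^ (3 / 2 - 3 / p.toReal) := by
  have hp0 : p ≠ 0 := (lt_of_lt_of_le (by norm_num) h2p).ne'
  have hptop : p ≠ ⊤ := ne_top_of_le_ne_top (by norm_num) hp6
  set r : ℝ := p.toReal with hr
  have h2r : 2 ≤ r := by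
    rw [hr, ← ENNReal.toReal_ofNat 2]; exact ENNReal.toReal_mono hptop h2p
  have hr6 : r ≤ 6 := by
    rw [hr, ← ENNReal.toReal_ofNat 6]; exact ENNReal.toReal_mono (by norm_num) hp6
  have hr0 : 0 < r := lt_of_lt_of_le zero_lt_two h2r
  have hint := lintegral_rpow_interpolate hf.enorm zero_lt_two (by norm_num : (2 : ℝ) < 6) h2r hr6
  rw [eLpNorm_eq_lintegral_rpow_enorm_toReal hp0 hptop,
    eLpNorm_eq_lintegral_rpow_enorm_toReal two_ne_zero ENNReal.ofNat_ne_top,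
    eLpNorm_eq_lintegral_rpow_enorm_toReal (by norm_num) (by norm_num : (6 : ℝ≥0∞) ≠ ⊤),
    ENNReal.toReal_ofNat, ENNReal.toReal_ofNat, ← hr, ← ENNReal.rpow_mul, ← ENNReal.rpow_mul]
  have h1 : 1 / (2 : ℝ) * (3 / r - 1 / 2) = (6 - r) / (6 - 2) * (1 / r) := by
    field_simp; ring
  have h2 : 1 / (6 : ℝ) * (3 / 2 - 3 / r) = (r - 2) / (6 - 2) * (1 / r) := by
    field_simp; ring
  rw [h1, h2, ENNReal.rpow_mul, ENNReal.rpow_mul, ← ENNReal.mul_rpow_of_nonneg _ _ (by positivity)]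
  exact ENNReal.rpow_le_rpow hint (by positivity)

end Interpolation

/-! ### Slice bounds for Leray–Hopf solutions in dimension `3` -/

section SliceBounds

variable {T ν : ℝ} {u₀ : E → E} {u : ℝ → E → E}

/-- The joint a.e.-measurability clause of a weak solution in product form. [folklore] -/
theorem IsLerayHopfOn.aestronglyMeasurable_uncurry {f : ℝ → E → E} (hu : IsLerayHopfOn T ν f u₀ u) :
    AEStronglyMeasurable (uncurry u) ((volume.restrict (Ioo 0 T)).prod (volume : Measure E)) := by
  rw [restrict_prod_volume_eq]; exact hu.weak.1

/-- The dissipation density `s ↦ ∫ |G(s)|²` of a jointly measurable gradient field is measurable. [folklore] -/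
theorem measurable_lintegral_frobeniusNormSq {G : ℝ → E → E →L[ℝ] E}
    (hG : StronglyMeasurable (uncurry G)) :
    Measurable fun s => ∫⁻ x, ENNReal.ofReal (frobeniusNormSq (G s x)) ∂(volume : Measure E) := by
  have h : Measurable fun p : ℝ × E => ENNReal.ofReal (frobeniusNormSq (uncurry G p)) :=
    ENNReal.measurable_ofReal.comp
      (NSWeakStrongUniqueness.continuous_frobeniusNormSq.comp_stronglyMeasurable hG).measurable
  exact h.lintegral_prod_right'

/-- **Uniform `L²` bound of the slices** of a Leray–Hopf solution under the energy inequality from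
`0`: `‖u(t)‖₂ ≤ (2 E(u₀))^{1/2}` for all `t ∈ [0,T]`. [folklore] -/
theorem IsLerayHopfOn.eLpNorm_two_le {f : ℝ → E → E} (hu : IsLerayHopfOn T ν f u₀ u)
    {G : ℝ → E → E →L[ℝ] E} (hν : 0 ≤ ν)
    (hE : ∀ t ∈ Icc 0 T, VectorCalculus.kineticEnergy (u t) +
      ν * (∫⁻ τ in Ioo 0 t, ∫⁻ x, ENNReal.ofReal (frobeniusNormSq (G τ x))).toReal ≤
        VectorCalculus.kineticEnergy u₀)
    {t : ℝ} (ht : t ∈ Icc 0 T) :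
    eLpNorm (u t) 2 volume ≤ ENNReal.ofReal (2 * VectorCalculus.kineticEnergy u₀) ^ (1 / 2 : ℝ) := by
  have hK : VectorCalculus.kineticEnergy (u t) ≤ VectorCalculus.kineticEnergy u₀ :=
    le_trans (le_add_of_nonneg_right (mul_nonneg hν ENNReal.toReal_nonneg)) (hE t ht)
  have h1 : eEnergy (u t) ≤ ENNReal.ofReal (2 * VectorCalculus.kineticEnergy u₀) := by
    rw [hu.eEnergy_eq ht]
    exact ENNReal.ofReal_le_ofReal (by linarith)
  rw [eEnergy_eq_eLpNorm_sq] at h1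
  calc eLpNorm (u t) 2 volume = (eLpNorm (u t) 2 volume ^ 2) ^ (1 / 2 : ℝ) := by
        rw [← ENNReal.rpow_natCast, ← ENNReal.rpow_mul]; norm_num
    _ ≤ ENNReal.ofReal (2 * VectorCalculus.kineticEnergy u₀) ^ (1 / 2 : ℝ) := ENNReal.rpow_le_rpow h1 (by norm_num)

/-- **Sobolev–interpolation bound for one slice** (dimension `3`): for `w ∈ L²` with weak
gradient `G` and `2 ≤ p ≤ 6`,
`‖w‖_p ≤ ‖w‖₂^{3/p-1/2} (K (∫|G|²)^{1/2})^{3/2-3/p}`, `K` Mathlib's Gagliardo–Nirenberg–Sobolev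
constant (Robinson–Rodrigo–Sadowski 2016, Thm. 1.5 with Thm. 1.7 (i), as in the proof of
Lemma 8.18). [cite: RobinsonRodrigoSadowski2016, proof of Lemma 8.18] -/
theorem eLpNorm_le_of_hasWeakGradient (hE3 : finrank ℝ E = 3) {w : E → E} {G : E → E →L[ℝ] E}
    (hw2 : MemLp w 2 volume) (hw : HasWeakGradient w G) {p : ℝ≥0∞} (h2p : 2 ≤ p) (hp6 : p ≤ 6) :
    eLpNorm w p volume ≤ eLpNorm w 2 volume ^ (3 / p.toReal - 1 / 2) *
      ((SNormLESNormFDerivOfEqConst E (volume : Measure E) 2 : ℝ≥0∞) *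
        (∫⁻ x, ENNReal.ofReal (frobeniusNormSq (G x))) ^ (1 / 2 : ℝ)) ^ (3 / 2 - 3 / p.toReal) := by
  have hp0 : p ≠ 0 := (lt_of_lt_of_le (by norm_num) h2p).ne'
  have hptop : p ≠ ⊤ := ne_top_of_le_ne_top (by norm_num) hp6
  have h3 : 0 ≤ 3 / 2 - 3 / p.toReal := by
    have : 2 ≤ p.toReal := by
      rw [← ENNReal.toReal_ofNat 2]; exact ENNReal.toReal_mono hptop h2p
    rw [sub_nonneg, div_le_div_iff₀ (by positivity) (by positivity)]
    linarith
  refine (eLpNorm_le_eLpNorm_two_rpow_mul_eLpNorm_six_rpow hw2.1 h2p hp6).trans ?_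
  gcongr
  exact eLpNorm_six_le_frobenius_of_hasWeakGradient hE3 hw2 hw

/-- **`∫₀ᵀ ‖u(s)‖₄² ds < ∞` for a Leray–Hopf solution in dimension `3`** with a jointly
measurable weak-gradient witness of finite dissipation (Robinson–Rodrigo–Sadowski 2016,
Lemma 3.5-type bound, `u ∈ L^{8/3}(0,T;L⁴)`): `‖u‖₄² ≤ ‖u‖₂^{1/2} ‖u‖₆^{3/2} ≤ C ‖∇u‖₂^{3/2}`
and `x^{3/4} ≤ 1 + x`. [cite: RobinsonRodrigoSadowski2016, Lemma 3.5] -/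
theorem IsLerayHopfOn.lintegral_eLpNorm_four_sq_lt_top (hE3 : finrank ℝ E = 3) {f : ℝ → E → E}
    (hu : IsLerayHopfOn T ν f u₀ u) {G : ℝ → E → E →L[ℝ] E}
    (hGm : StronglyMeasurable (uncurry G))
    (hG : ∀ᵐ t ∂(volume.restrict (Ioo 0 T)), HasWeakGradient (u t) (G t))
    (hG2 : ∫⁻ t in Ioo 0 T, ∫⁻ x, ENNReal.ofReal (frobeniusNormSq (G t x)) < ⊤) :
    ∫⁻ s in Ioo 0 T, eLpNorm (u s) 4 volume ^ (2 : ℝ) < ⊤ := by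
  obtain ⟨K, hK⟩ := hu.energy_bound
  set Cs : ℝ≥0∞ := (SNormLESNormFDerivOfEqConst E (volume : Measure E) 2 : ℝ≥0∞) with hCs
  set D : ℝ → ℝ≥0∞ := fun s => ∫⁻ x, ENNReal.ofReal (frobeniusNormSq (G s x)) with hD
  have hDm : Measurable D := measurable_lintegral_frobeniusNormSq hGm
  -- pointwise bound for a.e. `s`
  have hpt : ∀ᵐ s ∂(volume.restrict (Ioo 0 T)),
      eLpNorm (u s) 4 volume ^ (2 : ℝ) ≤ (K : ℝ≥0∞) ^ (1 / 4 : ℝ) * Cs ^ (3 / 2 : ℝ) * (1 + D s) := by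
    filter_upwards [hK, hG, ae_restrict_mem measurableSet_Ioo] with s hKs hGs hsI
    have hmem : MemLp (u s) 2 volume := hu.memLp s (Ioo_subset_Icc_self hsI)
    have h1 := eLpNorm_le_of_hasWeakGradient hE3 hmem hGs (p := 4) (by norm_num) (by norm_num)
    have h4 : (4 : ℝ≥0∞).toReal = 4 := ENNReal.toReal_ofNat 4
    rw [h4] at h1
    norm_num at h1
    -- `‖u‖₂ ≤ K^{1/2}`
    have h2 : eLpNorm (u s) 2 volume ≤ (K : ℝ≥0∞) ^ (1 / 2 : ℝ) := by
      rw [eEnergy_eq_eLpNorm_sq] at hKs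
      calc eLpNorm (u s) 2 volume = (eLpNorm (u s) 2 volume ^ 2) ^ (1 / 2 : ℝ) := by
            rw [← ENNReal.rpow_natCast, ← ENNReal.rpow_mul]; norm_num
        _ ≤ (K : ℝ≥0∞) ^ (1 / 2 : ℝ) := ENNReal.rpow_le_rpow hKs (by norm_num)
    calc eLpNorm (u s) 4 volume ^ (2 : ℝ)
        ≤ (eLpNorm (u s) 2 volume ^ (1 / 4 : ℝ) * (Cs * D s ^ (1 / 2 : ℝ)) ^ (3 / 4 : ℝ)) ^ (2 : ℝ) :=
          ENNReal.rpow_le_rpow h1 zero_le_two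
      _ = eLpNorm (u s) 2 volume ^ (1 / 2 : ℝ) * Cs ^ (3 / 2 : ℝ) * D s ^ (3 / 4 : ℝ) := by
          rw [ENNReal.mul_rpow_of_nonneg _ _ zero_le_two, ENNReal.mul_rpow_of_nonneg _ _ (by norm_num),
            ENNReal.mul_rpow_of_nonneg _ _ zero_le_two, ← ENNReal.rpow_mul, ← ENNReal.rpow_mul,
            ← ENNReal.rpow_mul, ← ENNReal.rpow_mul,
            show (1 : ℝ) / 4 * 2 = 1 / 2 by norm_num, show (3 : ℝ) / 4 * 2 = 3 / 2 by norm_num,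
            show (1 : ℝ) / 2 * ((3 : ℝ) / 2) = 3 / 4 by norm_num]
          ring
      _ ≤ ((K : ℝ≥0∞) ^ (1 / 2 : ℝ)) ^ (1 / 2 : ℝ) * Cs ^ (3 / 2 : ℝ) * (1 + D s) := by
          gcongr
          all_goals first
            | exact h2
            | exact ENNReal.rpow_le_one_add_self _ (by norm_num) (by norm_num)
      _ = (K : ℝ≥0∞) ^ (1 / 4 : ℝ) * Cs ^ (3 / 2 : ℝ) * (1 + D s) := by
          rw [← ENNReal.rpow_mul, show (1 : ℝ) / 2 * (1 / 2) = 1 / 4 by norm_num]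
  calc ∫⁻ s in Ioo 0 T, eLpNorm (u s) 4 volume ^ (2 : ℝ)
      ≤ ∫⁻ s in Ioo 0 T, (K : ℝ≥0∞) ^ (1 / 4 : ℝ) * Cs ^ (3 / 2 : ℝ) * (1 + D s) :=
        lintegral_mono_ae hpt
    _ = (K : ℝ≥0∞) ^ (1 / 4 : ℝ) * Cs ^ (3 / 2 : ℝ) * (volume (Ioo 0 T) + ∫⁻ s in Ioo 0 T, D s) := by
        rw [lintegral_const_mul _ (hDm.const_add 1), lintegral_add_left measurable_const,
          lintegral_const, Measure.restrict_apply_univ, one_mul]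
    _ < ⊤ := by
        refine ENNReal.mul_lt_top (ENNReal.mul_lt_top ?_ ?_) (ENNReal.add_lt_top.2 ⟨?_, hG2⟩)
        · exact ENNReal.rpow_lt_top_of_nonneg (by norm_num) ENNReal.coe_ne_top
        · exact ENNReal.rpow_lt_top_of_nonneg (by norm_num) ENNReal.coe_ne_top
        · rw [Real.volume_Ioo]; exact ENNReal.ofReal_lt_top

end SliceBounds

/-! ### The time-sliced weak formulation against `H¹_σ` fields -/

section H1Test

variable {T ν : ℝ} {u₀ : E → E} {u : ℝ → E → E}

/-- Real limits from `ℝ≥0∞` error bounds: if `‖xₙ - a‖ₑ ≤ eₙ → 0` then `xₙ → a`. [folklore] -/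
theorem tendsto_of_enorm_sub_le {x : ℕ → ℝ} {a : ℝ} {e : ℕ → ℝ≥0∞}
    (h : ∀ n, ‖x n - a‖ₑ ≤ e n) (he : Tendsto e atTop (𝓝 0)) : Tendsto x atTop (𝓝 a) := by
  have hev : ∀ᶠ n in atTop, e n < ⊤ :=
    (tendsto_order.1 he).2 ⊤ (by simp)
  have hle : ∀ᶠ n in atTop, ‖x n - a‖ ≤ (e n).toReal := by
    filter_upwards [hev] with n hn
    rw [← toReal_enorm]
    exact ENNReal.toReal_mono hn.ne (h n)
  have hto : Tendsto (fun n => (e n).toReal) atTop (𝓝 0) := by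
    have := (ENNReal.tendsto_toReal ENNReal.zero_ne_top).comp he
    rwa [ENNReal.toReal_zero] at this
  exact tendsto_sub_nhds_zero_iff.1 (squeeze_zero_norm' hle hto)

/-- The `L²` mass of a component `x ↦ L(x) eᵢ` is bounded by the Frobenius dissipation. [folklore] -/
theorem eLpNorm_apply_le_lintegral_frobenius_rpow (G : E → E →L[ℝ] E) (v : E) (hv : ‖v‖ = 1) :
    eLpNorm (fun x => G x v) 2 volume ≤
      (∫⁻ x, ENNReal.ofReal (frobeniusNormSq (G x))) ^ (1 / 2 : ℝ) := by
  refine le_trans ?_ (eLpNorm_two_le_lintegral_frobenius_rpow volume G)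
  refine eLpNorm_mono fun x => ?_
  calc ‖G x v‖ ≤ ‖G x‖ * ‖v‖ := (G x).le_opNorm v
    _ = ‖G x‖ := by rw [hv, mul_one]

/-- The pairing of two `L²` components of gradient fields is bounded by the dissipations. [folklore] -/
theorem enorm_integral_inner_apply_apply_le (G H : E → E →L[ℝ] E)
    (hG : AEStronglyMeasurable G volume) (hH : AEStronglyMeasurable H volume) (v : E) (hv : ‖v‖ = 1) :
    ‖∫ x, ⟪G x v, H x v⟫‖ₑ ≤ eLpNorm (fun x => G x v) 2 volume *
      (∫⁻ x, ENNReal.ofReal (frobeniusNormSq (H x))) ^ (1 / 2 : ℝ) := by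
  have hGv : AEStronglyMeasurable (fun x => G x v) volume :=
    (ContinuousLinearMap.apply ℝ E v).continuous.comp_aestronglyMeasurable hG
  have hHv : AEStronglyMeasurable (fun x => H x v) volume :=
    (ContinuousLinearMap.apply ℝ E v).continuous.comp_aestronglyMeasurable hH
  exact (FunctionSpaces.enorm_integral_inner_le_eLpNorm_mul hGv hHv).trans
    (mul_le_mul' le_rfl (eLpNorm_apply_le_lintegral_frobenius_rpow H v hv))

/-- A weak-gradient witness is a.e.-strongly measurable. [folklore] -/
theorem HasWeakGradient.aestronglyMeasurable_deriv {w : E → E} {G : E → E →L[ℝ] E}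
    (hw : HasWeakGradient w G) : AEStronglyMeasurable G volume :=
  (locallyIntegrableOn_univ.1 (by simpa only [Opens.coe_top] using hw.locallyIntegrableOn_deriv)
    ).aestronglyMeasurable

/-- The time-sliced weak flux of a Leray–Hopf solution against a pair `(A, Ψ)` standing for
`(∇Ψ, Ψ)`: the real function
`F(s) = ∫ ⟪A·u(s), u(s)⟫ - ν Σᵢ ∫ ⟪Gu(s) eᵢ, A eᵢ⟫` is a.e.-strongly measurable on `(0,T)` when
`u` is a.e. jointly measurable and `Gu` jointly measurable. [folklore] -/
theorem aestronglyMeasurable_weakFlux {A : E → E →L[ℝ] E} (hA : AEStronglyMeasurable A volume)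
    (hum : AEStronglyMeasurable (uncurry u) ((volume.restrict (Ioo 0 T)).prod (volume : Measure E)))
    {Gu : ℝ → E → E →L[ℝ] E} (hGum : StronglyMeasurable (uncurry Gu)) (ν : ℝ) :
    AEStronglyMeasurable (fun s => (∫ x, ⟪A x (u s x), u s x⟫) -
      ν * ∑ i, ∫ x, ⟪Gu s x (stdOrthonormalBasis ℝ E i), A x (stdOrthonormalBasis ℝ E i)⟫)
      (volume.restrict (Ioo 0 T)) := by
  set b := stdOrthonormalBasis ℝ E
  have h1 : AEStronglyMeasurable (fun s => ∫ x, ⟪A x (u s x), u s x⟫)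
      (volume.restrict (Ioo 0 T)) := by
    have hAu : AEStronglyMeasurable (fun p : ℝ × E => A p.2 (uncurry u p))
        ((volume.restrict (Ioo 0 T)).prod (volume : Measure E)) :=
      isBoundedBilinearMap_apply.continuous.comp_aestronglyMeasurable (hA.comp_snd.prodMk hum)
    exact (hAu.inner (𝕜 := ℝ) hum).integral_prod_right'
  have h2 : ∀ i, AEStronglyMeasurable (fun s => ∫ x, ⟪Gu s x (b i), A x (b i)⟫)
      (volume.restrict (Ioo 0 T)) := by
    intro i
    have hG : AEStronglyMeasurable (fun p : ℝ × E => Gu p.1 p.2 (b i))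
        ((volume.restrict (Ioo 0 T)).prod (volume : Measure E)) :=
      ((ContinuousLinearMap.apply ℝ E (b i)).continuous.comp_stronglyMeasurable
        hGum).aestronglyMeasurable
    have hAi : AEStronglyMeasurable (fun p : ℝ × E => A p.2 (b i))
        ((volume.restrict (Ioo 0 T)).prod (volume : Measure E)) :=
      ((ContinuousLinearMap.apply ℝ E (b i)).continuous.comp_aestronglyMeasurable hA).comp_snd
    exact (hG.inner (𝕜 := ℝ) hAi).integral_prod_right'
  exact h1.sub ((Finset.aestronglyMeasurable_fun_sum Finset.univ fun i _ => h2 i).const_mul ν)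

/-- **The error weight**: `∫₀ᵀ (‖u‖₄² + |ν| Σᵢ ‖Gu eᵢ‖₂) < ∞` for a Leray–Hopf solution in
dimension `3` with a jointly measurable weak-gradient witness of finite dissipation. [folklore] -/
theorem IsLerayHopfOn.lintegral_weight_lt_top (hE3 : finrank ℝ E = 3) {f : ℝ → E → E}
    (hu : IsLerayHopfOn T ν f u₀ u) {Gu : ℝ → E → E →L[ℝ] E}
    (hGum : StronglyMeasurable (uncurry Gu))
    (hGu : ∀ᵐ t ∂(volume.restrict (Ioo 0 T)), HasWeakGradient (u t) (Gu t))
    (hGu₂ : ∫⁻ t in Ioo 0 T, ∫⁻ x, ENNReal.ofReal (frobeniusNormSq (Gu t x)) < ⊤) :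
    ∫⁻ s in Ioo 0 T, (eLpNorm (u s) 4 volume ^ (2 : ℝ) + ENNReal.ofReal |ν| *
      ∑ i, eLpNorm (fun x => Gu s x (stdOrthonormalBasis ℝ E i)) 2 volume) < ⊤ := by
  set b := stdOrthonormalBasis ℝ E
  set D : ℝ → ℝ≥0∞ := fun s => ∫⁻ x, ENNReal.ofReal (frobeniusNormSq (Gu s x)) with hD
  have hDm : Measurable D := measurable_lintegral_frobeniusNormSq hGum
  have h4 := hu.lintegral_eLpNorm_four_sq_lt_top hE3 hGum hGu hGu₂
  have hcomp : ∀ i s, eLpNorm (fun x => Gu s x (b i)) 2 volume ≤ 1 + D s := fun i s =>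
    (eLpNorm_apply_le_lintegral_frobenius_rpow (Gu s) (b i) (b.orthonormal.1 i)).trans
      (ENNReal.rpow_le_one_add_self _ (by norm_num) (by norm_num))
  have hsum : ∫⁻ s in Ioo 0 T, ENNReal.ofReal |ν| * ∑ i, eLpNorm (fun x => Gu s x (b i)) 2 volume
      ≤ ENNReal.ofReal |ν| * (Fintype.card (Fin (finrank ℝ E)) * (volume (Ioo 0 T) + ∫⁻ s in Ioo 0 T, D s)) := by
    calc ∫⁻ s in Ioo 0 T, ENNReal.ofReal |ν| * ∑ i, eLpNorm (fun x => Gu s x (b i)) 2 volume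
        ≤ ∫⁻ s in Ioo 0 T, ENNReal.ofReal |ν| * ∑ _i : Fin (finrank ℝ E), (1 + D s) := by
          refine lintegral_mono fun s => ?_
          gcongr with i
          exact hcomp i s
      _ = ENNReal.ofReal |ν| * (Fintype.card (Fin (finrank ℝ E)) *
            (volume (Ioo 0 T) + ∫⁻ s in Ioo 0 T, D s)) := by
          simp only [Finset.sum_const, Finset.card_univ, nsmul_eq_mul]
          rw [lintegral_const_mul' _ _ ENNReal.ofReal_ne_top,
            lintegral_const_mul' _ _ (ENNReal.natCast_ne_top _), lintegral_add_left measurable_const,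
            lintegral_const, Measure.restrict_apply_univ, one_mul]
  rw [lintegral_add_left' ((FunctionSpaces.aemeasurable_eLpNorm_slice hu.aestronglyMeasurable_uncurry 4).pow_const _)]
  refine ENNReal.add_lt_top.2 ⟨h4, hsum.trans_lt ?_⟩
  refine ENNReal.mul_lt_top ENNReal.ofReal_lt_top (ENNReal.mul_lt_top (ENNReal.natCast_lt_top _)
    (ENNReal.add_lt_top.2 ⟨?_, hGu₂⟩))
  rw [Real.volume_Ioo]; exact ENNReal.ofReal_lt_top

/-- `4⁻¹ + 4⁻¹ = 2⁻¹`: the Hölder triple `(4, 4, 2)`. [folklore] -/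
theorem holderTriple_four_four_two : ENNReal.HolderTriple 4 4 2 := by
  refine ⟨?_⟩
  have h4 : (4 : ℝ≥0∞)⁻¹ = 2⁻¹ * 2⁻¹ := by
    rw [← ENNReal.mul_inv (Or.inl two_ne_zero) (Or.inl ENNReal.ofNat_ne_top)]; norm_num
  rw [h4, ← two_mul, ← mul_assoc, ENNReal.mul_inv_cancel two_ne_zero ENNReal.ofNat_ne_top, one_mul]

/-- **Pointwise error bound** at a good time: for `w ∈ L² ∩ L⁴`, a gradient field `G` with
components in `L²`, and two gradient densities `A₁, A₂` with `∫|A₁ - A₂|² = δ²`,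
`|F_{A₁}(w) - F_{A₂}(w)| ≤ δ (‖w‖₄² + |ν| Σᵢ ‖G eᵢ‖₂)` where
`F_A(w) = ∫ ⟪A w, w⟫ - ν Σᵢ ∫ ⟪G eᵢ, A eᵢ⟫` (three-factor Hölder and Cauchy–Schwarz;
Robinson–Rodrigo–Sadowski 2016, proof of Lemma 8.18, the density step). [folklore] -/
theorem enorm_weakFlux_sub_le {w : E → E} {G A₁ A₂ : E → E →L[ℝ] E}
    (hw4 : MemLp w 4 volume) (hG : AEStronglyMeasurable G volume)
    (hGi : ∀ i, MemLp (fun x => G x (stdOrthonormalBasis ℝ E i)) 2 volume)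
    (hA₁ : AEStronglyMeasurable A₁ volume) (hA₂ : AEStronglyMeasurable A₂ volume)
    (hA₁2 : ∫⁻ x, ENNReal.ofReal (frobeniusNormSq (A₁ x)) < ⊤)
    (hA₂2 : ∫⁻ x, ENNReal.ofReal (frobeniusNormSq (A₂ x)) < ⊤) (ν : ℝ) :
    ‖((∫ x, ⟪A₁ x (w x), w x⟫) - ν * ∑ i, ∫ x, ⟪G x (stdOrthonormalBasis ℝ E i),
        A₁ x (stdOrthonormalBasis ℝ E i)⟫) -
      ((∫ x, ⟪A₂ x (w x), w x⟫) - ν * ∑ i, ∫ x, ⟪G x (stdOrthonormalBasis ℝ E i),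
        A₂ x (stdOrthonormalBasis ℝ E i)⟫)‖ₑ ≤
      (∫⁻ x, ENNReal.ofReal (frobeniusNormSq (A₁ x - A₂ x))) ^ (1 / 2 : ℝ) *
        (eLpNorm w 4 volume ^ (2 : ℝ) + ENNReal.ofReal |ν| *
          ∑ i, eLpNorm (fun x => G x (stdOrthonormalBasis ℝ E i)) 2 volume) := by
  set b := stdOrthonormalBasis ℝ E with hb
  set δ : ℝ≥0∞ := (∫⁻ x, ENNReal.ofReal (frobeniusNormSq (A₁ x - A₂ x))) ^ (1 / 2 : ℝ) with hδ
  haveI : ENNReal.HolderTriple 4 4 2 := holderTriple_four_four_two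
  have hb1 : ∀ i, ‖b i‖ = 1 := fun i => b.orthonormal.1 i
  -- integrability of the trilinear terms
  have iT : ∀ {A : E → E →L[ℝ] E}, AEStronglyMeasurable A volume →
      ∫⁻ x, ENNReal.ofReal (frobeniusNormSq (A x)) < ⊤ →
      Integrable (fun x => ⟪A x (w x), w x⟫) volume := fun hA hA2 =>
    integrable_inner_apply_of_holder hA hA2 hw4 hw4
  -- components of the gradient densities are in `L²`
  have iS : ∀ {A : E → E →L[ℝ] E}, AEStronglyMeasurable A volume →
      ∫⁻ x, ENNReal.ofReal (frobeniusNormSq (A x)) < ⊤ → ∀ i,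
      Integrable (fun x => ⟪G x (b i), A x (b i)⟫) volume := by
    intro A hA hA2 i
    have hAi : MemLp (fun x => A x (b i)) 2 volume := by
      refine ⟨(ContinuousLinearMap.apply ℝ E (b i)).continuous.comp_aestronglyMeasurable hA, ?_⟩
      exact (eLpNorm_apply_le_lintegral_frobenius_rpow A (b i) (hb1 i)).trans_lt
        (ENNReal.rpow_lt_top_of_nonneg (by norm_num) hA2.ne)
    exact integrable_inner_of_memLp_two (hGi i) hAi
  -- rewrite the difference
  have hdiff_T : (∫ x, ⟪A₁ x (w x), w x⟫) - ∫ x, ⟪A₂ x (w x), w x⟫ =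
      ∫ x, ⟪(A₁ x - A₂ x) (w x), w x⟫ := by
    rw [← integral_sub (iT hA₁ hA₁2) (iT hA₂ hA₂2)]
    congr 1; ext x
    rw [_root_.sub_apply, inner_sub_left]
  have hdiff_S : (∑ i, ∫ x, ⟪G x (b i), A₁ x (b i)⟫) - ∑ i, ∫ x, ⟪G x (b i), A₂ x (b i)⟫ =
      ∑ i, ∫ x, ⟪G x (b i), (A₁ x - A₂ x) (b i)⟫ := by
    rw [← Finset.sum_sub_distrib]
    refine Finset.sum_congr rfl fun i _ => ?_
    rw [← integral_sub (iS hA₁ hA₁2 i) (iS hA₂ hA₂2 i)]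
    congr 1; ext x
    rw [_root_.sub_apply, inner_sub_right]
  have hA12 : AEStronglyMeasurable (fun x => A₁ x - A₂ x) volume := hA₁.sub hA₂
  have heq : ((∫ x, ⟪A₁ x (w x), w x⟫) - ν * ∑ i, ∫ x, ⟪G x (b i), A₁ x (b i)⟫) -
      ((∫ x, ⟪A₂ x (w x), w x⟫) - ν * ∑ i, ∫ x, ⟪G x (b i), A₂ x (b i)⟫) =
      (∫ x, ⟪(A₁ x - A₂ x) (w x), w x⟫) - ν * ∑ i, ∫ x, ⟪G x (b i), (A₁ x - A₂ x) (b i)⟫ := by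
    rw [← hdiff_T, ← hdiff_S]; ring
  rw [heq]
  -- bound the two pieces
  have hT : ‖∫ x, ⟪(A₁ x - A₂ x) (w x), w x⟫‖ₑ ≤ δ * eLpNorm w 4 volume ^ (2 : ℝ) := by
    refine (enorm_integral_le_lintegral_enorm _).trans ?_
    refine (lintegral_enorm_inner_apply_le hA12 hw4.1 hw4.1 4 4).trans (le_of_eq ?_)
    rw [hδ, ENNReal.rpow_two, sq]
  have hS : ‖ν * ∑ i, ∫ x, ⟪G x (b i), (A₁ x - A₂ x) (b i)⟫‖ₑ ≤
      ENNReal.ofReal |ν| * ∑ i, eLpNorm (fun x => G x (b i)) 2 volume * δ := by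
    rw [enorm_mul, Real.enorm_eq_ofReal_abs]
    gcongr
    refine (enorm_sum_le _ _).trans (Finset.sum_le_sum fun i _ => ?_)
    exact enorm_integral_inner_apply_apply_le G (fun x => A₁ x - A₂ x) hG hA12 (b i) (hb1 i)
  calc ‖(∫ x, ⟪(A₁ x - A₂ x) (w x), w x⟫) - ν * ∑ i, ∫ x, ⟪G x (b i), (A₁ x - A₂ x) (b i)⟫‖ₑ
      ≤ ‖∫ x, ⟪(A₁ x - A₂ x) (w x), w x⟫‖ₑ +
          ‖ν * ∑ i, ∫ x, ⟪G x (b i), (A₁ x - A₂ x) (b i)⟫‖ₑ := enorm_sub_le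
    _ ≤ δ * eLpNorm w 4 volume ^ (2 : ℝ) +
          ENNReal.ofReal |ν| * ∑ i, eLpNorm (fun x => G x (b i)) 2 volume * δ := add_le_add hT hS
    _ = δ * (eLpNorm w 4 volume ^ (2 : ℝ) +
          ENNReal.ofReal |ν| * ∑ i, eLpNorm (fun x => G x (b i)) 2 volume) := by
        rw [← Finset.sum_mul]; ring

/-- **Integrability of the `H¹_σ` weak flux.** For a Leray–Hopf solution `u` in dimension `3`
with a jointly measurable weak-gradient witness `Gu` of finite dissipation, and a gradient density
`A ∈ L²` (standing for `∇Ψ`), the time-sliced flux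
`F(s) = ∫ ⟪A u(s), u(s)⟫ - ν Σᵢ ∫ ⟪Gu(s) eᵢ, A eᵢ⟫` is integrable on `(0, T)`:
`|F(s)| ≤ ‖A‖₂ (‖u(s)‖₄² + |ν| Σᵢ ‖Gu(s) eᵢ‖₂)` and the weight is integrable
(`lintegral_weight_lt_top`). [folklore] -/
theorem IsLerayHopfOn.integrableOn_weakFlux (hE3 : finrank ℝ E = 3) {f : ℝ → E → E}
    (hu : IsLerayHopfOn T ν f u₀ u) {Gu : ℝ → E → E →L[ℝ] E}
    (hGum : StronglyMeasurable (uncurry Gu))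
    (hGu : ∀ᵐ t ∂(volume.restrict (Ioo 0 T)), HasWeakGradient (u t) (Gu t))
    (hGu₂ : ∫⁻ t in Ioo 0 T, ∫⁻ x, ENNReal.ofReal (frobeniusNormSq (Gu t x)) < ⊤)
    {A : E → E →L[ℝ] E} (hA : AEStronglyMeasurable A volume)
    (hA2 : ∫⁻ x, ENNReal.ofReal (frobeniusNormSq (A x)) < ⊤) :
    IntegrableOn (fun s => (∫ x, ⟪A x (u s x), u s x⟫) -
      ν * ∑ i, ∫ x, ⟪Gu s x (stdOrthonormalBasis ℝ E i), A x (stdOrthonormalBasis ℝ E i)⟫)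
      (Ioo 0 T) := by
  set b := stdOrthonormalBasis ℝ E with hb
  set W : ℝ → ℝ≥0∞ := fun s => eLpNorm (u s) 4 volume ^ (2 : ℝ) + ENNReal.ofReal |ν| *
    ∑ i, eLpNorm (fun x => Gu s x (b i)) 2 volume with hW
  have hIW : ∫⁻ s in Ioo 0 T, W s < ⊤ := hu.lintegral_weight_lt_top hE3 hGum hGu hGu₂
  have hDm : Measurable fun s => ∫⁻ x, ENNReal.ofReal (frobeniusNormSq (Gu s x)) :=
    measurable_lintegral_frobeniusNormSq hGum
  have hDfin : ∀ᵐ s ∂(volume.restrict (Ioo 0 T)), ∫⁻ x, ENNReal.ofReal (frobeniusNormSq (Gu s x)) < ⊤ :=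
    ae_lt_top hDm hGu₂.ne
  have h4fin : ∀ᵐ s ∂(volume.restrict (Ioo 0 T)), eLpNorm (u s) 4 volume < ⊤ := by
    have h := ae_lt_top' ((FunctionSpaces.aemeasurable_eLpNorm_slice hu.aestronglyMeasurable_uncurry 4).pow_const
      (2 : ℝ)) (hu.lintegral_eLpNorm_four_sq_lt_top hE3 hGum hGu hGu₂).ne
    filter_upwards [h] with s hs
    exact (ENNReal.rpow_lt_top_iff_of_pos zero_lt_two).1 hs
  refine ⟨aestronglyMeasurable_weakFlux hA hu.aestronglyMeasurable_uncurry hGum ν, ?_⟩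
  have hbound : ∀ᵐ s ∂(volume.restrict (Ioo 0 T)),
      ‖(∫ x, ⟪A x (u s x), u s x⟫) - ν * ∑ i, ∫ x, ⟪Gu s x (b i), A x (b i)⟫‖ₑ ≤
        (∫⁻ x, ENNReal.ofReal (frobeniusNormSq (A x))) ^ (1 / 2 : ℝ) * W s := by
    filter_upwards [hGu, ae_restrict_mem measurableSet_Ioo, hDfin, h4fin] with s hGs hsI hDs h4s
    have hmem2 : MemLp (u s) 2 volume := hu.memLp s (Ioo_subset_Icc_self hsI)
    have hmem4 : MemLp (u s) 4 volume := ⟨hmem2.1, h4s⟩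
    have hGi : ∀ i, MemLp (fun x => Gu s x (b i)) 2 volume := fun i => hGs.memLp_apply hDs i
    have h := enorm_weakFlux_sub_le hmem4 hGs.aestronglyMeasurable_deriv hGi hA
      (aestronglyMeasurable_const (b := (0 : E →L[ℝ] E))) hA2 (by simp) ν
    simpa only [Pi.zero_apply, _root_.zero_apply, inner_zero_left, inner_zero_right,
      integral_zero, Finset.sum_const_zero, mul_zero, sub_zero] using h
  calc ∫⁻ s in Ioo 0 T, ‖(∫ x, ⟪A x (u s x), u s x⟫) - ν * ∑ i, ∫ x, ⟪Gu s x (b i), A x (b i)⟫‖ₑ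
      ≤ ∫⁻ s in Ioo 0 T, (∫⁻ x, ENNReal.ofReal (frobeniusNormSq (A x))) ^ (1 / 2 : ℝ) * W s :=
        lintegral_mono_ae hbound
    _ = (∫⁻ x, ENNReal.ofReal (frobeniusNormSq (A x))) ^ (1 / 2 : ℝ) * ∫⁻ s in Ioo 0 T, W s := by
        rw [lintegral_const_mul' _ _ (ENNReal.rpow_lt_top_of_nonneg (by norm_num) hA2.ne).ne]
    _ < ⊤ := ENNReal.mul_lt_top (ENNReal.rpow_lt_top_of_nonneg (by norm_num) hA2.ne) hIW

/-- **The `H¹_σ` time-slice identity for Leray–Hopf solutions** (Galdi 2000, Lemma 2.1 with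
(2.8)/(4.3); Serrin 1963, (6); Robinson–Rodrigo–Sadowski 2016, Lemma 8.18, density step). Let
`dim E = 3`, `u` a Leray–Hopf weak solution of the unforced Navier–Stokes system on `E × [0,T)`
with datum `u₀`, `Gu` a jointly measurable weak-gradient witness of `u` (a.e. in time) with
`∫₀ᵀ ∫|Gu|² < ∞`, and `Ψ ∈ L²` weakly divergence free with weak gradient `GΨ`, `∫|GΨ|² < ∞`.
Then for every `t ∈ (0, T]`
`⟨u(t), Ψ⟩ = ⟨u₀, Ψ⟩ + ∫_{(0,t]} ( ∫ ⟪GΨ u, u⟫ - ν Σᵢ ∫ ⟪Gu eᵢ, GΨ eᵢ⟫ ) ds`,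
provided the datum `u₀ ∈ L²` (a standing hypothesis of the sources, Galdi 2000, Def. 2.1;
RRS 2016, Def. 3.3, which the accepted `IsLerayHopfOn` does not record).
Proof: approximate `Ψ` in `H¹` by divergence-free test fields `Φₙ`
(`exists_isDivFree_test_approx`), apply the accepted `IsLerayHopfOn.inner_test_eq` to `Φₙ`,
rewrite `ν⟨u, ΔΦₙ⟩ = -ν Σᵢ ⟨Gu eᵢ, ∂ᵢΦₙ⟩` (`HasWeakGradient.integral_inner_laplacian_test`) for
a.e. `s`, and pass to the limit using `enorm_weakFlux_sub_le` and `∫₀ᵀ(‖u‖₄² + |ν|Σ‖Gu eᵢ‖₂) < ∞`.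
[cite: Galdi2000, Lemma 2.1] -/
theorem IsLerayHopfOn.inner_weakGrad_test_eq (hE3 : finrank ℝ E = 3)
    (hu : IsLerayHopfOn T ν 0 u₀ u) (hu₀ : MemLp u₀ 2 volume) (hT : 0 < T)
    {Gu : ℝ → E → E →L[ℝ] E}
    (hGum : StronglyMeasurable (uncurry Gu))
    (hGu : ∀ᵐ t ∂(volume.restrict (Ioo 0 T)), HasWeakGradient (u t) (Gu t))
    (hGu₂ : ∫⁻ t in Ioo 0 T, ∫⁻ x, ENNReal.ofReal (frobeniusNormSq (Gu t x)) < ⊤)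
    {Ψ : E → E} {GΨ : E → E →L[ℝ] E} (hΨ2 : MemLp Ψ 2 volume) (hΨdiv : IsWeaklyDivFree Ψ)
    (hΨG : HasWeakGradient Ψ GΨ) (hGΨ2 : ∫⁻ x, ENNReal.ofReal (frobeniusNormSq (GΨ x)) < ⊤)
    {t : ℝ} (ht : t ∈ Ioc 0 T) :
    ∫ x, ⟪u t x, Ψ x⟫ = (∫ x, ⟪u₀ x, Ψ x⟫) +
      ∫ s in Ioc 0 t, ((∫ x, ⟪GΨ x (u s x), u s x⟫) -
        ν * ∑ i, ∫ x, ⟪Gu s x (stdOrthonormalBasis ℝ E i), GΨ x (stdOrthonormalBasis ℝ E i)⟫) := by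
  set b := stdOrthonormalBasis ℝ E with hb
  haveI : ENNReal.HolderTriple 4 4 2 := holderTriple_four_four_two
  have hb1 : ∀ i, ‖b i‖ = 1 := fun i => b.orthonormal.1 i
  have hGΨm : AEStronglyMeasurable GΨ volume := hΨG.aestronglyMeasurable_deriv
  -- ### the approximating test fields
  set δ : ℕ → ℝ≥0∞ := fun n => ((n + 1 : ℕ) : ℝ≥0∞)⁻¹ with hδdef
  have hδpos : ∀ n, 0 < δ n := fun n => ENNReal.inv_pos.2 (ENNReal.natCast_ne_top _)
  have hδtop : ∀ n, δ n ≠ ⊤ := fun n =>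
    ENNReal.inv_ne_top.2 (Nat.cast_ne_zero.2 (Nat.succ_ne_zero n))
  have hδlim : Tendsto δ atTop (𝓝 0) :=
    ENNReal.tendsto_inv_nat_nhds_zero.comp (tendsto_add_atTop_nat 1)
  have hδlim' : Tendsto (fun n => δ n ^ (1 / 2 : ℝ)) atTop (𝓝 0) := by
    have := ((ENNReal.continuous_rpow_const (y := 1 / 2)).tendsto (0 : ℝ≥0∞)).comp hδlim
    rwa [ENNReal.zero_rpow_of_pos (by norm_num)] at this
  choose Φ hΦtest hΦdiv hΦL2 hΦH1 using fun n : ℕ =>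
    exists_isDivFree_test_approx hE3 hΨ2 hΨdiv hΨG hGΨ2 (hδpos n)
  have hΦD : ∀ n, AEStronglyMeasurable (fderiv ℝ (Φ n)) volume := fun n =>
    ((hΦtest n).contDiff.continuous_fderiv (by simp)).aestronglyMeasurable
  have hΦDfin : ∀ n, ∫⁻ x, ENNReal.ofReal (frobeniusNormSq (fderiv ℝ (Φ n) x)) < ⊤ := by
    intro n
    have hc : Continuous (frobeniusNormSq ∘ fderiv ℝ (Φ n)) :=
      NSWeakStrongUniqueness.continuous_frobeniusNormSq.comp ((hΦtest n).contDiff.continuous_fderiv (by simp))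
    have hK : HasCompactSupport (frobeniusNormSq ∘ fderiv ℝ (Φ n)) :=
      ((hΦtest n).hasCompactSupport.fderiv ℝ).comp_left frobeniusNormSq_zero
    have hi : Integrable (frobeniusNormSq ∘ fderiv ℝ (Φ n)) volume :=
      hc.integrable_of_hasCompactSupport hK
    have h2 : ∫⁻ x, ‖(frobeniusNormSq ∘ fderiv ℝ (Φ n)) x‖ₑ < ⊤ := hi.2
    refine lt_of_le_of_lt (lintegral_mono fun x => ?_) h2
    exact Real.ofReal_le_enorm _
  -- ### notation: fluxes and the weight
  set FΦ : ℕ → ℝ → ℝ := fun n s =>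
    ∫ x, (⟪u s x, convect (u s) (Φ n) x⟫ + ν * ⟪u s x, (Δ (Φ n)) x⟫) with hFΦ
  set F : ℝ → ℝ := fun s => (∫ x, ⟪GΨ x (u s x), u s x⟫) -
    ν * ∑ i, ∫ x, ⟪Gu s x (b i), GΨ x (b i)⟫ with hF
  set W : ℝ → ℝ≥0∞ := fun s => eLpNorm (u s) 4 volume ^ (2 : ℝ) + ENNReal.ofReal |ν| *
    ∑ i, eLpNorm (fun x => Gu s x (b i)) 2 volume with hW
  have hIW : ∫⁻ s, W s ∂(volume.restrict (Ioo 0 T)) < ⊤ := hu.lintegral_weight_lt_top hE3 hGum hGu hGu₂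
  -- the identities for the test fields
  have hI : ∀ n, ∫ x, ⟪u t x, Φ n x⟫ = (∫ x, ⟪u₀ x, Φ n x⟫) + ∫ s in Ioc 0 t, FΦ n s :=
    fun n => by rw [hFΦ]; exact hu.inner_test_eq hT (hΦtest n) (hΦdiv n) ht
  -- ### the pointwise error bound for a.e. `s`
  set D : ℝ → ℝ≥0∞ := fun s => ∫⁻ x, ENNReal.ofReal (frobeniusNormSq (Gu s x)) with hD
  have hDm : Measurable D := measurable_lintegral_frobeniusNormSq hGum
  have hDfin : ∀ᵐ s ∂(volume.restrict (Ioo 0 T)), D s < ⊤ := ae_lt_top hDm hGu₂.ne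
  have h4fin : ∀ᵐ s ∂(volume.restrict (Ioo 0 T)), eLpNorm (u s) 4 volume < ⊤ := by
    have h := ae_lt_top' ((FunctionSpaces.aemeasurable_eLpNorm_slice hu.aestronglyMeasurable_uncurry 4).pow_const
      (2 : ℝ)) (hu.lintegral_eLpNorm_four_sq_lt_top hE3 hGum hGu hGu₂).ne
    filter_upwards [h] with s hs
    exact (ENNReal.rpow_lt_top_iff_of_pos zero_lt_two).1 hs
  have hgood : ∀ᵐ s ∂(volume.restrict (Ioo 0 T)), ∀ n, ‖FΦ n s - F s‖ₑ ≤ δ n ^ (1 / 2 : ℝ) * W s := by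
    filter_upwards [hGu, ae_restrict_mem measurableSet_Ioo, hDfin, h4fin] with s hGs hsI hDs h4s
    intro n
    have hmem2 : MemLp (u s) 2 volume := hu.memLp s (Ioo_subset_Icc_self hsI)
    have hmem4 : MemLp (u s) 4 volume := ⟨hmem2.1, h4s⟩
    -- rewrite the smooth flux in gradient form
    have i1 : Integrable (fun x => ⟪u s x, convect (u s) (Φ n) x⟫) volume :=
      integrable_inner_fderiv_apply_of_memLp_two hmem2 hmem2 (hΦtest n)
    have i2 : Integrable (fun x => ⟪u s x, (Δ (Φ n)) x⟫) volume :=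
      integrable_inner_of_memLp_two hmem2 ((hΦtest n).memLp_laplacian 2)
    have hflux : FΦ n s = (∫ x, ⟪fderiv ℝ (Φ n) x (u s x), u s x⟫) -
        ν * ∑ i, ∫ x, ⟪Gu s x (b i), fderiv ℝ (Φ n) x (b i)⟫ := by
      simp only [hFΦ]
      rw [integral_add i1 (i2.const_mul ν), MeasureTheory.integral_const_mul,
        hGs.integral_inner_laplacian_test (hΦtest n)]
      have : ∫ x, ⟪u s x, convect (u s) (Φ n) x⟫ = ∫ x, ⟪fderiv ℝ (Φ n) x (u s x), u s x⟫ :=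
        integral_congr_ae (ae_of_all _ fun x => by dsimp only; rw [convect_apply, real_inner_comm])
      rw [this]; ring
    rw [hflux]
    have hGi : ∀ i, MemLp (fun x => Gu s x (b i)) 2 volume := fun i => hGs.memLp_apply hDs i
    refine (enorm_weakFlux_sub_le hmem4 hGs.aestronglyMeasurable_deriv hGi (hΦD n) hGΨm
      (hΦDfin n) hGΨ2 ν).trans ?_
    exact mul_le_mul' (ENNReal.rpow_le_rpow (hΦH1 n) (by norm_num)) le_rfl
  -- ### integrability of the fluxes on `(0, T)`
  have hWm : AEMeasurable W (volume.restrict (Ioo 0 T)) := by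
    refine ((FunctionSpaces.aemeasurable_eLpNorm_slice hu.aestronglyMeasurable_uncurry 4).pow_const _).add
      (AEMeasurable.const_mul (Finset.aemeasurable_fun_sum _ fun i _ => ?_) _)
    exact (FunctionSpaces.measurable_eLpNorm_slice (g := fun s x => Gu s x (b i))
      ((ContinuousLinearMap.apply ℝ E (b i)).continuous.comp_stronglyMeasurable hGum) 2).aemeasurable
  have hFΦint : ∀ n, IntegrableOn (FΦ n) (Ioo 0 T) := fun n => by
    rw [hFΦ]; exact hu.integrableOn_flux (hΦtest n)
  have hFint : IntegrableOn F (Ioo 0 T) :=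
    hu.integrableOn_weakFlux hE3 hGum hGu hGu₂ hGΨm hGΨ2
  -- ### integrability on `(0, t]`
  have hsub : Ioo 0 t ⊆ Ioo 0 T := Ioo_subset_Ioo le_rfl ht.2
  have hFΦt : ∀ n, IntegrableOn (FΦ n) (Ioc 0 t) := fun n =>
    (integrableOn_Ioc_iff_integrableOn_Ioo (hb := enorm_ne_top)).2 ((hFΦint n).mono_set hsub)
  have hFt : IntegrableOn F (Ioc 0 t) :=
    (integrableOn_Ioc_iff_integrableOn_Ioo (hb := enorm_ne_top)).2 (hFint.mono_set hsub)
  -- ### limit of the flux integrals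
  have hflux_lim : Tendsto (fun n => ∫ s in Ioc 0 t, FΦ n s) atTop (𝓝 (∫ s in Ioc 0 t, F s)) := by
    refine tendsto_of_enorm_sub_le (e := fun n => δ n ^ (1 / 2 : ℝ) * ∫⁻ s, W s ∂(volume.restrict (Ioo 0 T)))
      (fun n => ?_) ?_
    · rw [← integral_sub (hFΦt n) hFt]
      calc ‖∫ s in Ioc 0 t, (FΦ n s - F s)‖ₑ ≤ ∫⁻ s in Ioc 0 t, ‖FΦ n s - F s‖ₑ :=
            enorm_integral_le_lintegral_enorm _
        _ = ∫⁻ s in Ioo 0 t, ‖FΦ n s - F s‖ₑ := setLIntegral_congr Ioo_ae_eq_Ioc.symm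
        _ ≤ ∫⁻ s in Ioo 0 T, ‖FΦ n s - F s‖ₑ := lintegral_mono_set hsub
        _ ≤ ∫⁻ s in Ioo 0 T, δ n ^ (1 / 2 : ℝ) * W s :=
            lintegral_mono_ae (hgood.mono fun s hs => hs n)
        _ = δ n ^ (1 / 2 : ℝ) * ∫⁻ s, W s ∂(volume.restrict (Ioo 0 T)) := lintegral_const_mul'' _ hWm
    · have h := ENNReal.Tendsto.mul_const hδlim' (Or.inr hIW.ne)
      rwa [zero_mul] at h
  -- ### limits of the pairings
  have hpair : ∀ {v : E → E}, MemLp v 2 volume →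
      Tendsto (fun n => ∫ x, ⟪v x, Φ n x⟫) atTop (𝓝 (∫ x, ⟪v x, Ψ x⟫)) := by
    intro v hv
    refine tendsto_of_enorm_sub_le (e := fun n => eLpNorm v 2 volume * δ n) (fun n => ?_) ?_
    · rw [← integral_sub (integrable_inner_of_memLp_two hv ((hΦtest n).memLp_volume 2))
        (integrable_inner_of_memLp_two hv hΨ2)]
      have : (fun x => ⟪v x, Φ n x⟫ - ⟪v x, Ψ x⟫) = fun x => ⟪v x, (Φ n - Ψ) x⟫ := by
        ext x; rw [Pi.sub_apply, inner_sub_right]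
      rw [this]
      exact (FunctionSpaces.enorm_integral_inner_le_eLpNorm_mul hv.1
        (((hΦtest n).memLp_volume 2).sub hΨ2).1).trans (mul_le_mul' le_rfl (hΦL2 n))
    · have h := ENNReal.Tendsto.const_mul hδlim (Or.inr hv.eLpNorm_ne_top)
      rwa [mul_zero] at h
  have hL := hpair (hu.memLp t ⟨ht.1.le, ht.2⟩)
  have hR := (hpair hu₀).add hflux_lim
  have hLR : (fun n => ∫ x, ⟪u t x, Φ n x⟫) =
      fun n => (∫ x, ⟪u₀ x, Φ n x⟫) + ∫ s in Ioc 0 t, FΦ n s := funext hI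
  rw [hLR] at hL
  exact tendsto_nhds_unique hL hR

end H1Test

end Literature.Analysis.FluidPDE
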